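import Literature.Computability.Complexity.TimeBoundsProofs
import Mathlib.Data.Fintype.Option
import HarnessLib

/-!
# Stack programs over a finite alphabet, with exact running time on Mathlib's `TM2`

Trunk `CplxCore`, toolkit for `TimeBounds.lean` (per-input time bounds), companion of
`StackMachines.lean` / `StackPrograms.lean`. Those files compile structured programs over
*binary* stack registers to stack register machines and put the computed string functions in
`FP`, going through clocked transducer simulations whose overhead is polynomial but not
explicit. Fine-grained statements (`Literature.Computability.FineGrained.ComputesInTime`: a *per-input* time bound
such as `2^{εn} · poly(L)`) need two things more: registers over the *alphabet of the encoding*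
(the input word of the Turing machine is the register content, with no transcoding), and an
**exact** step count on `TM2`. This file provides both:

* `AInstr Γ ι`, `AProg Γ ι`, `AProg.step` — stack register machines whose registers `k : ι`
  hold words over a finite alphabet `Γ`: `push k a`, `pop k j` (pop register `k` and jump to
  `j o`, `o : Option Γ` the popped symbol, `none` if the register was empty), `goto j`; a
  program counter at or beyond the end of the program means *halted*;
* `ACom Γ ι` — structured programs `push k a | pop k f | c₁ ;; c₂ | skip | loop k f` with
  `f` a family of branches indexed by the popped symbol (`Option Γ`, resp. `Γ` for `loop k f`:
  "while register `k` is nonempty, pop a symbol `a` and run `f a`"); `ACom.Exec c R R' t` — its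
  big-step semantics with the **exact cost** `t` of the compiled code; `ACom.Runs` — executions
  within a budget, with the composition rules used to verify program libraries;
* `ACom.code`, `ACom.Exec.iterate_step` — compilation to `AProg` and its adequacy: an execution
  of cost `t` is exactly `t` machine steps (Nipkow–Klein, *Concrete Semantics*, Ch. 8, with step
  counting, as in `StackPrograms.lean`);
* `AProg.tm`, `AProg.outputsWithin_of_iterate` — **a stack register machine is a `TM2` machine**:
  the registers are the stacks of a `Turing.FinTM2` (labels = program addresses, one machine step
  per instruction), the input register is the input stack and the output register the output
  stack, so that a run of `t` instructions from the input configuration to a halted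
  configuration holding only the output is `OutputsWithin … t`;
* `ACom.exists_computesInTime` — **main result**: if for every input `a` the program `c`, started
  with `ea a` in register `inp` (all other registers empty), executes with cost `≤ T a` and ends
  with `eb (f a)` in register `out` (all other registers empty), then some `TM2` machine computes
  `f` in time `T a + 1` in the sense of `Literature.Computability.Complexity.ComputesInTime` (equivalently
  `Literature.Computability.FineGrained.ComputesInTime`, `exists_computesInTime_iff`).

So a fine-grained upper bound "`f` is computable in time `T`" reduces to writing a structured
program and proving a `Runs` statement about it, with no Turing machine in sight.

## References

* M. L. Minsky, *Computation: Finite and Infinite Machines*, Prentice-Hall 1967, §11.1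
  (program machines), §14.1 (push-down registers). (Not held; the model is standard.)
* T. Nipkow, G. Klein, *Concrete Semantics with Isabelle/HOL*, Springer 2014, Ch. 7 (big-step
  semantics), Ch. 8 (compiler onto a jump machine and its correctness). (Not held; the
  construction is standard and fully proved here.)
* S. Arora, B. Barak, *Computational Complexity: A Modern Approach*, CUP 2009, §1.2–1.3
  (multi-tape machines, running time; robustness of the model).
-/

namespace Literature.Computability.Complexity

open _root_.Computability

/-! ### Register stores -/

/-- Register stores: register `k : ι` holds a word over `Γ` (head of the list = top of the
stack). [folklore] -/
abbrev AStore (Γ ι : Type) : Type := ι → List Γ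

/-- The store with the word `z` in register `k` and all other registers empty: the initial store
(input in `inp`) and the final store (output in `out`) of a computation. [folklore] -/
def AStore.single {Γ ι : Type} [DecidableEq ι] (k : ι) (z : List Γ) : AStore Γ ι :=
  fun i => if i = k then z else []

/-- The designated register of `single k z` holds `z`. [folklore] -/
@[simp] theorem AStore.single_self {Γ ι : Type} [DecidableEq ι] (k : ι) (z : List Γ) :
    AStore.single k z k = z := by simp [AStore.single]

/-- The other registers of `single k z` are empty. [folklore] -/
theorem AStore.single_of_ne {Γ ι : Type} [DecidableEq ι] {k i : ι} (h : i ≠ k) (z : List Γ) :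
    AStore.single k z i = [] := by simp [AStore.single, h]

/-- `single k z` is the update of the empty store. [folklore] -/
theorem AStore.single_eq_update {Γ ι : Type} [DecidableEq ι] (k : ι) (z : List Γ) :
    AStore.single k z = Function.update (fun _ => []) k z := by
  funext i
  by_cases h : i = k
  · subst h; simp
  · rw [AStore.single_of_ne h, Function.update_of_ne h]

/-! ### Stack register machines over an alphabet -/

/-- Instructions of a stack register machine with registers `ι` over the alphabet `Γ`:
`push k a` (then fall through), `pop k j` (pop register `k` and jump to `j o`, where
`o : Option Γ` is the popped symbol, `none` if the register was empty and is left unchanged),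
`goto j`. Jump targets are absolute addresses. [Minsky 1967, §11.1, §14.1] [folklore] -/
inductive AInstr (Γ ι : Type) where
  | push (k : ι) (a : Γ) : AInstr Γ ι
  | pop (k : ι) (j : Option Γ → ℕ) : AInstr Γ ι
  | goto (j : ℕ) : AInstr Γ ι

/-- Configurations: program counter and register store. [Minsky 1967, §11.1] [folklore] -/
structure ACfg (Γ ι : Type) where
  /-- program counter (any value `≥` program length means: halted) -/
  pc : ℕ
  /-- register contents -/
  regs : AStore Γ ι

/-- A program: instruction `i` at position `i`. [Minsky 1967, §11.1] [folklore] -/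
abbrev AProg (Γ ι : Type) := List (AInstr Γ ι)

namespace AProg

variable {Γ ι : Type} [DecidableEq ι] (P : AProg Γ ι)

/-- One step of the machine (total: a halted configuration is fixed).
[Minsky 1967, §11.1, §14.1] [folklore] -/
def step (c : ACfg Γ ι) : ACfg Γ ι :=
  match P[c.pc]? with
  | none => c
  | some (.push k a) => ⟨c.pc + 1, Function.update c.regs k (a :: c.regs k)⟩
  | some (.goto j) => ⟨j, c.regs⟩
  | some (.pop k j) =>
    match c.regs k with
    | [] => ⟨j none, c.regs⟩
    | a :: w => ⟨j (some a), Function.update c.regs k w⟩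

/-- A halted configuration is a fixed point of `step`. [folklore] -/
theorem step_of_le {c : ACfg Γ ι} (h : P.length ≤ c.pc) : P.step c = c := by
  unfold step
  rw [List.getElem?_eq_none_iff.2 h]

/-- Hence of all its iterates. [folklore] -/
theorem iterate_step_of_le {c : ACfg Γ ι} (h : P.length ≤ c.pc) (t : ℕ) : P.step^[t] c = c :=
  Function.iterate_fixed (P.step_of_le h) t

/-- One machine step at an address holding a given instruction. [folklore] -/
theorem step_of_getElem? {pc : ℕ} {ins : AInstr Γ ι} (h : P[pc]? = some ins) (R : AStore Γ ι) :
    P.step ⟨pc, R⟩ =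
      match ins with
      | .push k a => ⟨pc + 1, Function.update R k (a :: R k)⟩
      | .goto j => ⟨j, R⟩
      | .pop k j =>
        match R k with
        | [] => ⟨j none, R⟩
        | a :: w => ⟨j (some a), Function.update R k w⟩ := by
  unfold step
  simp only [h]
  cases ins <;> rfl

end AProg

/-! ### Structured programs -/

/-- Structured stack programs over registers `ι` with alphabet `Γ`: `push k a`; `pop k f` — pop
register `k` and continue with `f o`, `o` the popped symbol (`none`: the register was empty);
`c₁ ;; c₂`; `skip`; `loop k f` — while register `k` is nonempty, pop its top symbol `a` and run
`f a` (destructive iteration; a body may refill the register, and then the loop is a genuine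
while-loop whose termination is part of what an `Exec` derivation asserts).
[Nipkow–Klein 2014, Ch. 7–8; Minsky 1967, §11.1] [folklore] -/
inductive ACom (Γ ι : Type) where
  | push (k : ι) (a : Γ) : ACom Γ ι
  | pop (k : ι) (f : Option Γ → ACom Γ ι) : ACom Γ ι
  | seq (c₁ c₂ : ACom Γ ι) : ACom Γ ι
  | skip : ACom Γ ι
  | loop (k : ι) (f : Γ → ACom Γ ι) : ACom Γ ι

namespace ACom

/-- Sequential composition. -/
infixr:30 " ;; " => ACom.seq

/-- Renaming the registers of a program along `f : ι → κ` (used to run a verified routine on a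
sub-bank of a larger register file). [folklore] -/
def map {Γ ι κ : Type} (f : ι → κ) : ACom Γ ι → ACom Γ κ
  | push k a => push (f k) a
  | pop k g => pop (f k) fun o => (g o).map f
  | seq c₁ c₂ => seq (c₁.map f) (c₂.map f)
  | skip => skip
  | loop k g => loop (f k) fun a => (g a).map f

section Semantics

variable {Γ ι : Type} [DecidableEq ι]

/-! ### Big-step semantics with exact cost -/

/-- `Exec c R R' t`: started on the store `R`, the program `c` terminates after exactly `t`
machine steps of its compiled code with store `R'`. Costs: `push` 1, `skip` 0, a `pop` 2 plus the
branch taken (the `pop` instruction and the jump out of the branch), a loop exit 1, a loop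
iteration 2 plus its body. [Nipkow–Klein 2014, §7.2 (big-step rules)] [folklore] -/
inductive Exec : ACom Γ ι → AStore Γ ι → AStore Γ ι → ℕ → Prop
  | push {k : ι} {a : Γ} {R : AStore Γ ι} :
      Exec (push k a) R (Function.update R k (a :: R k)) 1
  | pop_cons {k : ι} {f : Option Γ → ACom Γ ι} {R R' : AStore Γ ι} {a : Γ} {w : List Γ} {t : ℕ}
      (hk : R k = a :: w) (h : Exec (f (some a)) (Function.update R k w) R' t) :
      Exec (pop k f) R R' (t + 2)
  | pop_nil {k : ι} {f : Option Γ → ACom Γ ι} {R R' : AStore Γ ι} {t : ℕ}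
      (hk : R k = []) (h : Exec (f none) R R' t) :
      Exec (pop k f) R R' (t + 2)
  | seq {c₁ c₂ : ACom Γ ι} {R R₁ R₂ : AStore Γ ι} {t₁ t₂ : ℕ}
      (h₁ : Exec c₁ R R₁ t₁) (h₂ : Exec c₂ R₁ R₂ t₂) :
      Exec (c₁ ;; c₂) R R₂ (t₁ + t₂)
  | skip {R : AStore Γ ι} : Exec skip R R 0
  | loop_nil {k : ι} {f : Γ → ACom Γ ι} {R : AStore Γ ι} (hk : R k = []) :
      Exec (loop k f) R R 1
  | loop_cons {k : ι} {f : Γ → ACom Γ ι} {R R₁ R₂ : AStore Γ ι} {a : Γ} {w : List Γ}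
      {t₁ t₂ : ℕ} (hk : R k = a :: w) (h₁ : Exec (f a) (Function.update R k w) R₁ t₁)
      (h₂ : Exec (loop k f) R₁ R₂ t₂) :
      Exec (loop k f) R R₂ (t₁ + 2 + t₂)

/-- The semantics is deterministic: final store and cost are determined. [Nipkow–Klein 2014,
§7.2] [folklore] -/
theorem Exec.determ {c : ACom Γ ι} {R R₁ R₂ : AStore Γ ι} {t₁ t₂ : ℕ} (h₁ : Exec c R R₁ t₁)
    (h₂ : Exec c R R₂ t₂) : R₁ = R₂ ∧ t₁ = t₂ := by
  induction h₁ generalizing R₂ t₂ with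
  | push => cases h₂; exact ⟨rfl, rfl⟩
  | pop_cons hk h ih =>
    cases h₂ with
    | pop_cons hk' h' =>
      rw [hk] at hk'
      obtain ⟨rfl, rfl⟩ := List.cons.inj hk'
      obtain ⟨rfl, rfl⟩ := ih h'
      exact ⟨rfl, rfl⟩
    | pop_nil hk' h' => rw [hk] at hk'; exact absurd hk' (List.cons_ne_nil _ _)
  | pop_nil hk h ih =>
    cases h₂ with
    | pop_cons hk' h' => rw [hk] at hk'; exact absurd hk'.symm (List.cons_ne_nil _ _)
    | pop_nil hk' h' =>
      obtain ⟨rfl, rfl⟩ := ih h'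
      exact ⟨rfl, rfl⟩
  | seq h h' ih ih' =>
    cases h₂ with
    | seq g g' =>
      obtain ⟨rfl, rfl⟩ := ih g
      obtain ⟨rfl, rfl⟩ := ih' g'
      exact ⟨rfl, rfl⟩
  | skip => cases h₂; exact ⟨rfl, rfl⟩
  | loop_nil hk =>
    cases h₂ with
    | loop_nil => exact ⟨rfl, rfl⟩
    | loop_cons hk' => rw [hk] at hk'; exact absurd hk'.symm (List.cons_ne_nil _ _)
  | loop_cons hk h h' ih ih' =>
    cases h₂ with
    | loop_nil hk' => rw [hk] at hk'; exact absurd hk' (List.cons_ne_nil _ _)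
    | loop_cons hk' g g' =>
      rw [hk] at hk'
      obtain ⟨rfl, rfl⟩ := List.cons.inj hk'
      obtain ⟨rfl, rfl⟩ := ih g
      obtain ⟨rfl, rfl⟩ := ih' g'
      exact ⟨rfl, rfl⟩

/-! ### Executions within a budget -/

/-- `Runs c R R' B`: from `R`, the program `c` terminates with store `R'` at cost at most `B`.
[Nipkow–Klein 2014, §7.2] [folklore] -/
def Runs (c : ACom Γ ι) (R R' : AStore Γ ι) (B : ℕ) : Prop :=
  ∃ t ≤ B, Exec c R R' t

/-- Budgets may be increased. [folklore] -/
theorem Runs.mono {c : ACom Γ ι} {R R' : AStore Γ ι} {B B' : ℕ} (h : Runs c R R' B)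
    (hB : B ≤ B') : Runs c R R' B' := by
  obtain ⟨t, ht, e⟩ := h; exact ⟨t, ht.trans hB, e⟩

/-- Rewriting the final store. [folklore] -/
theorem Runs.congr {c : ACom Γ ι} {R R' R'' : AStore Γ ι} {B : ℕ} (h : Runs c R R' B)
    (e : R' = R'') : Runs c R R'' B := e ▸ h

/-- Rewriting the final store and enlarging the budget. [folklore] -/
theorem Runs.of_eq {c : ACom Γ ι} {R R₁ R' : AStore Γ ι} {B₁ B : ℕ} (h : Runs c R R₁ B₁)
    (hR : R₁ = R') (hB : B₁ ≤ B) : Runs c R R' B := (h.congr hR).mono hB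

/-- `push`. [folklore] -/
theorem Runs.push (k : ι) (a : Γ) (R : AStore Γ ι) :
    Runs (push k a) R (Function.update R k (a :: R k)) 1 :=
  ⟨1, le_rfl, Exec.push⟩

/-- `push`, with the resulting store given up to an equation. [folklore] -/
theorem Runs.push' {k : ι} {a : Γ} {R R' : AStore Γ ι}
    (hR : Function.update R k (a :: R k) = R') : Runs (ACom.push k a) R R' 1 :=
  hR ▸ Runs.push k a R

/-- `skip`. [folklore] -/
theorem Runs.skip (R : AStore Γ ι) : Runs skip R R 0 := ⟨0, le_rfl, Exec.skip⟩

/-- Sequencing. [folklore] -/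
theorem Runs.seq {c₁ c₂ : ACom Γ ι} {R R₁ R₂ : AStore Γ ι} {B₁ B₂ : ℕ} (h₁ : Runs c₁ R R₁ B₁)
    (h₂ : Runs c₂ R₁ R₂ B₂) : Runs (c₁ ;; c₂) R R₂ (B₁ + B₂) := by
  obtain ⟨t₁, ht₁, e₁⟩ := h₁; obtain ⟨t₂, ht₂, e₂⟩ := h₂
  exact ⟨t₁ + t₂, Nat.add_le_add ht₁ ht₂, Exec.seq e₁ e₂⟩

/-- `pop` on a nonempty register. [folklore] -/
theorem Runs.pop_cons {k : ι} {f : Option Γ → ACom Γ ι} {R R' : AStore Γ ι} {a : Γ}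
    {w : List Γ} {B : ℕ} (hk : R k = a :: w) (h : Runs (f (some a)) (Function.update R k w) R' B) :
    Runs (pop k f) R R' (B + 2) := by
  obtain ⟨t, ht, e⟩ := h; exact ⟨t + 2, by omega, Exec.pop_cons hk e⟩

/-- `pop` on a nonempty register, with the popped store given up to an equation. [folklore] -/
theorem Runs.pop_cons' {k : ι} {f : Option Γ → ACom Γ ι} {R R₀ R' : AStore Γ ι} {a : Γ}
    {w : List Γ} {B : ℕ} (hk : R k = a :: w) (hR : Function.update R k w = R₀)
    (h : Runs (f (some a)) R₀ R' B) : Runs (pop k f) R R' (B + 2) :=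
  Runs.pop_cons hk (hR ▸ h)

/-- `pop` on an empty register. [folklore] -/
theorem Runs.pop_nil {k : ι} {f : Option Γ → ACom Γ ι} {R R' : AStore Γ ι} {B : ℕ}
    (hk : R k = []) (h : Runs (f none) R R' B) : Runs (pop k f) R R' (B + 2) := by
  obtain ⟨t, ht, e⟩ := h; exact ⟨t + 2, by omega, Exec.pop_nil hk e⟩

/-- Loop exit. [folklore] -/
theorem Runs.loop_nil {k : ι} (f : Γ → ACom Γ ι) {R : AStore Γ ι} (hk : R k = []) :
    Runs (loop k f) R R 1 :=
  ⟨1, le_rfl, Exec.loop_nil hk⟩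

/-- Loop iteration. [folklore] -/
theorem Runs.loop_cons {k : ι} {f : Γ → ACom Γ ι} {R R₁ R₂ : AStore Γ ι} {a : Γ} {w : List Γ}
    {B₁ B₂ : ℕ} (hk : R k = a :: w) (h₁ : Runs (f a) (Function.update R k w) R₁ B₁)
    (h₂ : Runs (loop k f) R₁ R₂ B₂) : Runs (loop k f) R R₂ (B₁ + 2 + B₂) := by
  obtain ⟨t₁, ht₁, e₁⟩ := h₁; obtain ⟨t₂, ht₂, e₂⟩ := h₂
  exact ⟨t₁ + 2 + t₂, by omega, Exec.loop_cons hk e₁ e₂⟩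

/-- Loop iteration, with the popped store given up to an equation. [folklore] -/
theorem Runs.loop_cons' {k : ι} {f : Γ → ACom Γ ι} {R R₀ R₁ R₂ : AStore Γ ι} {a : Γ}
    {w : List Γ} {B₁ B₂ : ℕ} (hk : R k = a :: w) (hR : Function.update R k w = R₀)
    (h₁ : Runs (f a) R₀ R₁ B₁) (h₂ : Runs (loop k f) R₁ R₂ B₂) :
    Runs (loop k f) R R₂ (B₁ + 2 + B₂) :=
  Runs.loop_cons hk (hR ▸ h₁) h₂

/-! ### Renaming registers -/

/-- Grafting a store `R'` on `ι` into `S` on `κ` along `f`: registers in the range of `f` are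
read from `R'`, the others from `S` (Mathlib's `Function.extend f R' S`). [folklore] -/
noncomputable abbrev graft {κ : Type} (S : AStore Γ κ) (f : ι → κ) (R' : AStore Γ ι) :
    AStore Γ κ :=
  Function.extend f R' S

omit [DecidableEq ι] in
/-- Grafted values on the range. [folklore] -/
theorem graft_apply {κ : Type} (S : AStore Γ κ) {f : ι → κ} (hf : Function.Injective f)
    (R' : AStore Γ ι) (i : ι) : graft S f R' (f i) = R' i :=
  hf.extend_apply R' S i

omit [DecidableEq ι] in
/-- Grafted values off the range. [folklore] -/
theorem graft_of_not {κ : Type} (S : AStore Γ κ) (f : ι → κ) (R' : AStore Γ ι) {k : κ}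
    (hk : ∀ i, f i ≠ k) : graft S f R' k = S k :=
  Function.extend_apply' R' S k fun ⟨i, hi⟩ => hk i hi

omit [DecidableEq ι] in
/-- Grafting twice along the same map keeps the last graft. [folklore] -/
theorem graft_graft {κ : Type} (S : AStore Γ κ) {f : ι → κ} (hf : Function.Injective f)
    (R₁ R₂ : AStore Γ ι) : graft (graft S f R₁) f R₂ = graft S f R₂ := by
  funext k
  by_cases h : ∃ j, f j = k
  · obtain ⟨j, rfl⟩ := h; rw [graft_apply _ hf, graft_apply _ hf]
  · have hk : ∀ j, f j ≠ k := fun j hj => h ⟨j, hj⟩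
    rw [graft_of_not _ _ _ hk, graft_of_not _ _ _ hk, graft_of_not _ _ _ hk]

omit [DecidableEq ι] in
/-- Grafting after an update inside the range. [folklore] -/
theorem graft_update {κ : Type} [DecidableEq κ] (S : AStore Γ κ) {f : ι → κ}
    (hf : Function.Injective f) (R' : AStore Γ ι) (i : ι) (v : List Γ) :
    graft (Function.update S (f i) v) f R' = graft S f R' := by
  funext k
  by_cases h : ∃ j, f j = k
  · obtain ⟨j, rfl⟩ := h; rw [graft_apply S hf, graft_apply _ hf]
  · have hk : ∀ j, f j ≠ k := fun j hj => h ⟨j, hj⟩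
    rw [graft_of_not _ _ _ hk, graft_of_not _ _ _ hk, Function.update_of_ne]
    exact fun e => hk i e.symm

omit [DecidableEq ι] in
/-- Grafting the store one reads from changes nothing. [folklore] -/
theorem graft_self {κ : Type} (S : AStore Γ κ) {f : ι → κ} (hf : Function.Injective f)
    (R : AStore Γ ι) (hS : ∀ i, S (f i) = R i) : graft S f R = S := by
  funext k
  by_cases h : ∃ j, f j = k
  · obtain ⟨j, rfl⟩ := h; rw [graft_apply S hf, hS]
  · exact graft_of_not _ _ _ fun j hj => h ⟨j, hj⟩

/-- An update read through `f`. [folklore] -/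
theorem update_apply_map {κ : Type} [DecidableEq κ] (S : AStore Γ κ) {f : ι → κ}
    (hf : Function.Injective f) (R : AStore Γ ι) (hS : ∀ i, S (f i) = R i) (k : ι) (v : List Γ)
    (i : ι) : Function.update S (f k) v (f i) = Function.update R k v i := by
  by_cases h : i = k
  · subst h; simp
  · rw [Function.update_of_ne (hf.ne h), Function.update_of_ne h, hS]

/-- Grafting an updated store is updating the graft. [folklore] -/
theorem graft_update_eq {κ : Type} [DecidableEq κ] (S : AStore Γ κ) {f : ι → κ}
    (hf : Function.Injective f) (R : AStore Γ ι) (k : ι) (v : List Γ) :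
    graft S f (Function.update R k v) = Function.update (graft S f R) (f k) v := by
  funext x
  by_cases h : ∃ j, f j = x
  · obtain ⟨j, rfl⟩ := h
    rw [graft_apply S hf]
    by_cases hj : j = k
    · subst hj; simp
    · rw [Function.update_of_ne hj, Function.update_of_ne (hf.ne hj), graft_apply S hf]
  · have hk : ∀ j, f j ≠ x := fun j hj => h ⟨j, hj⟩
    rw [graft_of_not _ _ _ hk, Function.update_of_ne (hk k).symm, graft_of_not _ _ _ hk]

/-- **Executions are preserved by injective renaming of registers**, the registers outside the
range being untouched. [folklore] -/
theorem Exec.map {κ : Type} [DecidableEq κ] {f : ι → κ} (hf : Function.Injective f) {c : ACom Γ ι}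
    {R R' : AStore Γ ι} {t : ℕ} (h : Exec c R R' t) :
    ∀ (S : AStore Γ κ), (∀ i, S (f i) = R i) → Exec (c.map f) S (graft S f R') t := by
  induction h with
  | @push k a R =>
    intro S hS
    have e : graft S f (Function.update R k (a :: R k)) =
        Function.update S (f k) (a :: S (f k)) := by
      rw [graft_update_eq S hf, graft_self S hf R hS, hS]
    rw [ACom.map, e]
    exact Exec.push
  | pop_cons hk h ih =>
    intro S hS
    rw [ACom.map]
    refine Exec.pop_cons (by rw [hS, hk]) ?_
    have := ih _ (update_apply_map S hf _ hS _ _)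
    rwa [graft_update S hf] at this
  | pop_nil hk h ih =>
    intro S hS
    rw [ACom.map]
    exact Exec.pop_nil (by rw [hS, hk]) (ih S hS)
  | @seq c₁ c₂ R R₁ R₂ t₁ t₂ h₁ h₂ ih₁ ih₂ =>
    intro S hS
    rw [ACom.map]
    refine Exec.seq (ih₁ S hS) ?_
    have := ih₂ (graft S f R₁) (fun i => graft_apply S hf R₁ i)
    rwa [graft_graft S hf] at this
  | @skip R => intro S hS; rw [ACom.map, graft_self S hf R hS]; exact Exec.skip
  | @loop_nil k g R hk =>
    intro S hS; rw [ACom.map, graft_self S hf R hS]; exact Exec.loop_nil (by rw [hS, hk])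
  | @loop_cons k g R R₁ R₂ a w t₁ t₂ hk h₁ h₂ ih₁ ih₂ =>
    intro S hS
    rw [ACom.map]
    have e₁ := ih₁ _ (update_apply_map S hf _ hS k w)
    rw [graft_update S hf] at e₁
    have e₂ := ih₂ (graft S f R₁) (fun i => graft_apply S hf R₁ i)
    rw [ACom.map, graft_graft S hf] at e₂
    exact Exec.loop_cons (by rw [hS, hk]) e₁ e₂

/-- `Runs` under injective renaming. [folklore] -/
theorem Runs.map {κ : Type} [DecidableEq κ] {f : ι → κ} (hf : Function.Injective f)
    {c : ACom Γ ι} {R R' : AStore Γ ι} {B : ℕ} (h : Runs c R R' B) (S : AStore Γ κ)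
    (hS : ∀ i, S (f i) = R i) : Runs (c.map f) S (graft S f R') B := by
  obtain ⟨t, ht, e⟩ := h; exact ⟨t, ht, e.map hf S hS⟩

omit [DecidableEq ι] in
/-- Grafting into `Sum.elim R T` along `Sum.inl` replaces the left store. [folklore] -/
theorem graft_inl {κ : Type} (R R' : AStore Γ ι) (T : AStore Γ κ) :
    graft (Sum.elim R T) Sum.inl R' = Sum.elim R' T := by
  funext k
  cases k with
  | inl i => exact graft_apply _ Sum.inl_injective _ i
  | inr j => rw [graft_of_not _ _ _ (fun i => Sum.inl_ne_inr)]; rfl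

omit [DecidableEq ι] in
/-- Grafting into `Sum.elim T R` along `Sum.inr` replaces the right store. [folklore] -/
theorem graft_inr {κ : Type} (T : AStore Γ κ) (R R' : AStore Γ ι) :
    graft (Sum.elim T R) Sum.inr R' = Sum.elim T R' := by
  funext k
  cases k with
  | inr i => exact graft_apply _ Sum.inr_injective _ i
  | inl j => rw [graft_of_not _ _ _ (fun i => Sum.inr_ne_inl)]; rfl

/-- **A program on the left registers of a sum runs there, leaving the right registers alone.**
[folklore] -/
theorem Runs.inl {κ : Type} [DecidableEq κ] {c : ACom Γ ι} {R R' : AStore Γ ι} {B : ℕ}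
    (h : Runs c R R' B) (T : AStore Γ κ) :
    Runs (c.map Sum.inl) (Sum.elim R T) (Sum.elim R' T) B := by
  have H := h.map Sum.inl_injective (Sum.elim R T) (fun _ => rfl)
  rwa [graft_inl] at H

/-- **A program on the right registers of a sum runs there, leaving the left registers alone.**
[folklore] -/
theorem Runs.inr {κ : Type} [DecidableEq κ] {c : ACom Γ ι} {R R' : AStore Γ ι} {B : ℕ}
    (h : Runs c R R' B) (T : AStore Γ κ) :
    Runs (c.map Sum.inr) (Sum.elim T R) (Sum.elim T R') B := by
  have H := h.map Sum.inr_injective (Sum.elim T R) (fun _ => rfl)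
  rwa [graft_inr] at H

/-! ### Program library: loops with an invariant, and generic register utilities -/

/-- **Loops by invariant.** Describe the store during `loop k f` as a function `S done rest` of
the symbols consumed so far (`done`, most recent first) and those remaining in `k` (`rest`),
restricted to the pairs satisfying `Good`. If `Good` is preserved and each iteration leads from
`S done (a :: rest)` (with `k` popped) to `S (a :: done) rest` within budget `B`, then the loop
leads from `S done rest` to `S (rest.reverse ++ done) []` within `(B + 2) · |rest| + 1`.
[Nipkow–Klein 2014, §7.2 (loop unfolding)] [folklore] -/
theorem runs_loop_inv {k : ι} {f : Γ → ACom Γ ι} (S : List Γ → List Γ → AStore Γ ι)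
    (Good : List Γ → List Γ → Prop) (B : ℕ)
    (hk : ∀ done rest, Good done rest → S done rest k = rest)
    (hstep : ∀ done a rest, Good done (a :: rest) → Good (a :: done) rest ∧
      Runs (f a) (Function.update (S done (a :: rest)) k rest) (S (a :: done) rest) B) :
    ∀ (rest done : List Γ), Good done rest →
      Runs (loop k f) (S done rest) (S (rest.reverse ++ done) []) ((B + 2) * rest.length + 1)
  | [], done, hg => by simpa using Runs.loop_nil f (R := S done []) (hk done [] hg)
  | a :: rest, done, hg => by
    obtain ⟨hg', hb⟩ := hstep done a rest hg
    have ih := runs_loop_inv S Good B hk hstep rest (a :: done) hg'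
    have := Runs.loop_cons (hk done (a :: rest) hg) hb ih
    refine this.of_eq (by simp) ?_
    simp only [List.length_cons]
    ring_nf
    omega

/-- `SegExec k f u R R' t`: the body of `loop k f` iterated over the symbols of `u`, popped one
by one from register `k`, leads from `R` to `R'` at exact cost `t` (a *segment* of a loop
execution; loops over structured register contents are verified segment by segment).
[Nipkow–Klein 2014, §7.2 (loop unfolding)] [folklore] -/
inductive SegExec (k : ι) (f : Γ → ACom Γ ι) : List Γ → AStore Γ ι → AStore Γ ι → ℕ → Prop
  | nil {R : AStore Γ ι} : SegExec k f [] R R 0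
  | cons {a : Γ} {u w : List Γ} {R R₁ R₂ : AStore Γ ι} {t₁ t₂ : ℕ} (hk : R k = a :: w)
      (h₁ : Exec (f a) (Function.update R k w) R₁ t₁) (h₂ : SegExec k f u R₁ R₂ t₂) :
      SegExec k f (a :: u) R R₂ (t₁ + 2 + t₂)

/-- A segment followed by the rest of the loop is the loop. [folklore] -/
theorem SegExec.exec_loop {k : ι} {f : Γ → ACom Γ ι} {u : List Γ} {R R₁ R₂ : AStore Γ ι}
    {t₁ t₂ : ℕ} (h₁ : SegExec k f u R R₁ t₁) (h₂ : Exec (loop k f) R₁ R₂ t₂) :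
    Exec (loop k f) R R₂ (t₁ + t₂) := by
  induction h₁ with
  | nil => simpa using h₂
  | cons hk e _ ih =>
    have := Exec.loop_cons hk e (ih h₂)
    rwa [show _ + 2 + _ + t₂ = _ + 2 + (_ + t₂) from Nat.add_assoc _ _ _]

/-- Concatenation of segments. [folklore] -/
theorem SegExec.append {k : ι} {f : Γ → ACom Γ ι} {u v : List Γ} {R R₁ R₂ : AStore Γ ι}
    {t₁ t₂ : ℕ} (h₁ : SegExec k f u R R₁ t₁) (h₂ : SegExec k f v R₁ R₂ t₂) :
    SegExec k f (u ++ v) R R₂ (t₁ + t₂) := by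
  induction h₁ with
  | nil => simpa using h₂
  | cons hk e _ ih =>
    have := SegExec.cons hk e (ih h₂)
    rwa [List.cons_append, show _ + 2 + _ + t₂ = _ + 2 + (_ + t₂) from Nat.add_assoc _ _ _]

/-- `SegRuns k f u R R' B`: a loop segment over `u` within budget `B`. [folklore] -/
def SegRuns (k : ι) (f : Γ → ACom Γ ι) (u : List Γ) (R R' : AStore Γ ι) (B : ℕ) : Prop :=
  ∃ t ≤ B, SegExec k f u R R' t

/-- The empty segment. [folklore] -/
theorem SegRuns.nil (k : ι) (f : Γ → ACom Γ ι) (R : AStore Γ ι) : SegRuns k f [] R R 0 :=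
  ⟨0, le_rfl, SegExec.nil⟩

/-- One iteration, then a segment. [folklore] -/
theorem SegRuns.cons {k : ι} {f : Γ → ACom Γ ι} {a : Γ} {u w : List Γ} {R R₁ R₂ : AStore Γ ι}
    {B₁ B₂ : ℕ} (hk : R k = a :: w) (h₁ : Runs (f a) (Function.update R k w) R₁ B₁)
    (h₂ : SegRuns k f u R₁ R₂ B₂) : SegRuns k f (a :: u) R R₂ (B₁ + 2 + B₂) := by
  obtain ⟨t₁, ht₁, e₁⟩ := h₁; obtain ⟨t₂, ht₂, e₂⟩ := h₂
  exact ⟨t₁ + 2 + t₂, by omega, SegExec.cons hk e₁ e₂⟩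

/-- One iteration, with the popped store given up to an equation, then a segment. [folklore] -/
theorem SegRuns.cons' {k : ι} {f : Γ → ACom Γ ι} {a : Γ} {u w : List Γ} {R R₀ R₁ R₂ : AStore Γ ι}
    {B₁ B₂ : ℕ} (hk : R k = a :: w) (hR : Function.update R k w = R₀) (h₁ : Runs (f a) R₀ R₁ B₁)
    (h₂ : SegRuns k f u R₁ R₂ B₂) : SegRuns k f (a :: u) R R₂ (B₁ + 2 + B₂) :=
  SegRuns.cons hk (hR ▸ h₁) h₂

/-- A one-symbol segment. [folklore] -/
theorem SegRuns.single {k : ι} {f : Γ → ACom Γ ι} {a : Γ} {w : List Γ} {R R₁ : AStore Γ ι}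
    {B : ℕ} (hk : R k = a :: w) (h : Runs (f a) (Function.update R k w) R₁ B) :
    SegRuns k f [a] R R₁ (B + 2) := by
  simpa using SegRuns.cons hk h (SegRuns.nil k f R₁)

/-- Concatenation of segments. [folklore] -/
theorem SegRuns.append {k : ι} {f : Γ → ACom Γ ι} {u v : List Γ} {R R₁ R₂ : AStore Γ ι}
    {B₁ B₂ : ℕ} (h₁ : SegRuns k f u R R₁ B₁) (h₂ : SegRuns k f v R₁ R₂ B₂) :
    SegRuns k f (u ++ v) R R₂ (B₁ + B₂) := by
  obtain ⟨t₁, ht₁, e₁⟩ := h₁; obtain ⟨t₂, ht₂, e₂⟩ := h₂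
  exact ⟨t₁ + t₂, by omega, e₁.append e₂⟩

/-- A segment followed by the rest of the loop. [folklore] -/
theorem SegRuns.runs_loop {k : ι} {f : Γ → ACom Γ ι} {u : List Γ} {R R₁ R₂ : AStore Γ ι}
    {B₁ B₂ : ℕ} (h₁ : SegRuns k f u R R₁ B₁) (h₂ : Runs (loop k f) R₁ R₂ B₂) :
    Runs (loop k f) R R₂ (B₁ + B₂) := by
  obtain ⟨t₁, ht₁, e₁⟩ := h₁; obtain ⟨t₂, ht₂, e₂⟩ := h₂
  exact ⟨t₁ + t₂, by omega, e₁.exec_loop e₂⟩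

/-- A segment exhausting the register completes the loop. [folklore] -/
theorem SegRuns.runs_loop_nil {k : ι} {f : Γ → ACom Γ ι} {u : List Γ} {R R₁ : AStore Γ ι}
    {B : ℕ} (h₁ : SegRuns k f u R R₁ B) (hk : R₁ k = []) : Runs (loop k f) R R₁ (B + 1) :=
  h₁.runs_loop (Runs.loop_nil f hk)

/-- Budgets of segments may be increased. [folklore] -/
theorem SegRuns.mono {k : ι} {f : Γ → ACom Γ ι} {u : List Γ} {R R' : AStore Γ ι} {B B' : ℕ}
    (h : SegRuns k f u R R' B) (hB : B ≤ B') : SegRuns k f u R R' B' := by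
  obtain ⟨t, ht, e⟩ := h; exact ⟨t, ht.trans hB, e⟩

/-- Rewriting the final store of a segment and enlarging its budget. [folklore] -/
theorem SegRuns.of_eq {k : ι} {f : Γ → ACom Γ ι} {u : List Γ} {R R₁ R' : AStore Γ ι}
    {B₁ B : ℕ} (h : SegRuns k f u R R₁ B₁) (hR : R₁ = R') (hB : B₁ ≤ B) :
    SegRuns k f u R R' B :=
  hR ▸ h.mono hB

/-- **Segments by invariant** (cf. `runs_loop_inv`): if the store is `S done rest` as a function
of the consumed and remaining symbols (for pairs satisfying `Good`), each iteration costing at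
most `B`, then the segment over `u` leads from `S done (u ++ v)` to `S (u.reverse ++ done) v`.
[folklore] -/
theorem segRuns_inv {k : ι} {f : Γ → ACom Γ ι} (S : List Γ → List Γ → AStore Γ ι)
    (Good : List Γ → List Γ → Prop) (B : ℕ)
    (hk : ∀ done rest, Good done rest → S done rest k = rest)
    (hstep : ∀ done a rest, Good done (a :: rest) → Good (a :: done) rest ∧
      Runs (f a) (Function.update (S done (a :: rest)) k rest) (S (a :: done) rest) B) :
    ∀ (u v done : List Γ), Good done (u ++ v) →
      SegRuns k f u (S done (u ++ v)) (S (u.reverse ++ done) v) ((B + 2) * u.length)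
  | [], v, done, _ => by simpa using SegRuns.nil k f (S done v)
  | a :: u, v, done, hg => by
    obtain ⟨hg', hb⟩ := hstep done a (u ++ v) hg
    have ih := segRuns_inv S Good B hk hstep u v (a :: done) hg'
    have := SegRuns.cons (hk done (a :: (u ++ v)) hg) hb ih
    refine this.of_eq (by simp) ?_
    simp only [List.length_cons]
    ring_nf
    omega

/-- Push the symbols of `w` in order onto register `k` (afterwards it reads
`w.reverse ++ old`). [folklore] -/
def pushList (k : ι) : List Γ → ACom Γ ι
  | [] => skip
  | a :: w => push k a ;; pushList k w

/-- Effect and cost of `pushList`. [folklore] -/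
theorem runs_pushList (k : ι) : ∀ (w : List Γ) (R : AStore Γ ι),
    Runs (pushList k w) R (Function.update R k (w.reverse ++ R k)) w.length
  | [], R => by simpa [pushList] using Runs.skip R
  | a :: w, R => by
    have h := (Runs.push k a R).seq (runs_pushList k w (Function.update R k (a :: R k)))
    refine h.of_eq ?_ (by simp; omega)
    simp

/-- `clear k`: empty register `k`. [folklore] -/
def clear (k : ι) : ACom Γ ι := loop k fun _ => skip

/-- Effect and cost of `clear`. [folklore] -/
theorem runs_clear (k : ι) (R : AStore Γ ι) :
    Runs (clear k) R (Function.update R k []) (2 * (R k).length + 1) := by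
  have h := runs_loop_inv (k := k) (f := fun _ => skip) (fun _ rest => Function.update R k rest)
    (fun _ _ => True) 0 (fun _ _ _ => by simp)
    (fun done a rest _ => ⟨trivial, by simpa using Runs.skip (Function.update R k rest)⟩)
    (R k) [] trivial
  simp only [Function.update_eq_self, zero_add] at h
  exact h.mono (by omega)

/-- `pour a b`: move register `a` onto register `b`, reversing it (afterwards `b` reads
`(old a).reverse ++ old b`). [folklore] -/
def pour (a b : ι) : ACom Γ ι := loop a fun x => push b x

/-- Effect and cost of `pour`. [folklore] -/
theorem runs_pour {a b : ι} (hab : a ≠ b) (R : AStore Γ ι) :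
    Runs (pour a b) R (Function.update (Function.update R a []) b ((R a).reverse ++ R b))
      (3 * (R a).length + 1) := by
  have h := runs_loop_inv (k := a) (f := fun x => push b x)
    (fun done rest => Function.update (Function.update R a rest) b (done ++ R b))
    (fun _ _ => True) 1
    (fun done rest _ => by simp [Function.update_of_ne hab])
    (fun done x rest _ => ⟨trivial, by
      refine Runs.push' ?_
      funext r
      obtain rfl | hra := eq_or_ne a r
      · simp [Function.update_of_ne hab]
      · obtain rfl | hrb := eq_or_ne b r
        · simp [Function.update_of_ne hab.symm]
        · simp [Function.update_of_ne hra.symm, Function.update_of_ne hrb.symm]⟩)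
    (R a) [] trivial
  simp only [List.nil_append, Function.update_eq_self, List.append_nil] at h
  exact h.mono (by omega)

/-- `copy2 a b c`: move register `a` onto both `b` and `c`, reversing it (a non-destructive
read is `copy2 a b c` followed by `pour c a`). [folklore] -/
def copy2 (a b c : ι) : ACom Γ ι := loop a fun x => push b x ;; push c x

/-- Effect and cost of `copy2`. [folklore] -/
theorem runs_copy2 {a b c : ι} (hab : a ≠ b) (hac : a ≠ c) (hbc : b ≠ c) (R : AStore Γ ι) :
    Runs (copy2 a b c) R
      (Function.update (Function.update (Function.update R a []) b ((R a).reverse ++ R b)) c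
        ((R a).reverse ++ R c))
      (4 * (R a).length + 1) := by
  have h := runs_loop_inv (k := a) (f := fun x => push b x ;; push c x)
    (fun done rest => Function.update (Function.update (Function.update R a rest) b
      (done ++ R b)) c (done ++ R c))
    (fun _ _ => True) 2
    (fun done rest _ => by simp [Function.update_of_ne hab, Function.update_of_ne hac])
    (fun done x rest _ => ⟨trivial, by
      refine (Runs.push' rfl).seq (Runs.push' ?_)
      funext r
      obtain rfl | hra := eq_or_ne a r
      · simp [Function.update_of_ne hab, Function.update_of_ne hac]
      · obtain rfl | hrb := eq_or_ne b r
        · simp [Function.update_of_ne hbc, Function.update_of_ne hab.symm]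
        · obtain rfl | hrc := eq_or_ne c r
          · simp [Function.update_of_ne hbc.symm, Function.update_of_ne hac.symm]
          · simp [Function.update_of_ne hra.symm, Function.update_of_ne hrb.symm,
              Function.update_of_ne hrc.symm]⟩)
    (R a) [] trivial
  simp only [List.nil_append, Function.update_eq_self, List.append_nil] at h
  exact h.mono (by omega)

/-- `ifTop k f`: branch on the top symbol of register `k` without consuming it (pop, push back,
continue with `f o`). [folklore] -/
def ifTop (k : ι) (f : Option Γ → ACom Γ ι) : ACom Γ ι :=
  pop k fun o => match o with
    | some x => push k x ;; f (some x)
    | none => f none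

/-- `ifTop` on a nonempty register. [folklore] -/
theorem Runs.ifTop_cons {k : ι} {f : Option Γ → ACom Γ ι} {R R' : AStore Γ ι} {x : Γ}
    {w : List Γ} {B : ℕ} (hk : R k = x :: w) (h : Runs (f (some x)) R R' B) :
    Runs (ifTop k f) R R' (B + 3) := by
  have h1 : Runs (ACom.push k x) (Function.update R k w) R 1 := Runs.push' (by
    rw [Function.update_idem, Function.update_self, ← hk, Function.update_eq_self])
  have := Runs.pop_cons (f := fun o => match o with
    | some x => ACom.push k x ;; f (some x)
    | none => f none) hk (h1.seq h)
  exact this.mono (by omega)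

/-- `ifTop` on an empty register. [folklore] -/
theorem Runs.ifTop_nil {k : ι} {f : Option Γ → ACom Γ ι} {R R' : AStore Γ ι} {B : ℕ}
    (hk : R k = []) (h : Runs (f none) R R' B) : Runs (ifTop k f) R R' (B + 2) :=
  Runs.pop_nil (f := fun o => match o with
    | some x => ACom.push k x ;; f (some x)
    | none => f none) hk h

/-- `atLeast k n A B`: pop up to `n` symbols from register `k`; if all `n` pops succeed run `A`
(with those `n` symbols removed), otherwise (register exhausted first) run `B` (with the
register emptied). Used to compare a unary counter with a constant threshold. [folklore] -/
def atLeast (k : ι) : ℕ → ACom Γ ι → ACom Γ ι → ACom Γ ι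
  | 0, A, _ => A
  | n + 1, A, B => pop k fun o => match o with
    | some _ => atLeast k n A B
    | none => B

/-- `atLeast` when the register holds at least `n` symbols. [folklore] -/
theorem Runs.atLeast_ge {k : ι} {A B : ACom Γ ι} : ∀ {n : ℕ} {R R' : AStore Γ ι} {C : ℕ},
    n ≤ (R k).length → Runs A (Function.update R k ((R k).drop n)) R' C →
      Runs (atLeast k n A B) R R' (C + 2 * n)
  | 0, R, R', C, _, h => by simpa [atLeast] using h
  | n + 1, R, R', C, hn, h => by
    rw [atLeast]
    cases hk : R k with
    | nil => rw [hk] at hn; simp at hn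
    | cons x w =>
      rw [hk, List.length_cons] at hn
      have h' : Runs A (Function.update (Function.update R k w) k
          ((Function.update R k w k).drop n)) R' C := by
        simpa [hk] using h
      have := Runs.atLeast_ge (A := A) (B := B) (n := n) (R := Function.update R k w)
        (by simpa using hn) h'
      exact (Runs.pop_cons hk this).mono (by omega)

/-- `atLeast` when the register holds fewer than `n` symbols. [folklore] -/
theorem Runs.atLeast_lt {k : ι} {A B : ACom Γ ι} : ∀ {n : ℕ} {R R' : AStore Γ ι} {C : ℕ},
    (R k).length < n → Runs B (Function.update R k []) R' C →
      Runs (atLeast k n A B) R R' (C + 2 * n)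
  | 0, R, R', C, hn, _ => absurd hn (Nat.not_lt_zero _)
  | n + 1, R, R', C, hn, h => by
    rw [atLeast]
    cases hk : R k with
    | nil =>
      have h' : Runs B R R' C := by rwa [← hk, Function.update_eq_self] at h
      exact (Runs.pop_nil hk h').mono (by omega)
    | cons x w =>
      rw [hk, List.length_cons] at hn
      have h' : Runs B (Function.update (Function.update R k w) k []) R' C := by simpa using h
      have := Runs.atLeast_lt (A := A) (B := B) (n := n) (R := Function.update R k w)
        (by simpa using hn) h'
      exact (Runs.pop_cons hk this).mono (by omega)

end Semantics

/-! ### Compilation to stack register machines -/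

section Compile

variable {Γ ι : Type} [Fintype Γ] [DecidableEq Γ]

/-- The alphabet as a list (an arbitrary but fixed enumeration, used to lay out the branches of
`loop`). [folklore] -/
noncomputable def syms (Γ : Type) [Fintype Γ] : List Γ := (Finset.univ : Finset Γ).toList

/-- The possible results of a `pop` as a list (used to lay out the branches of `pop`).
[folklore] -/
noncomputable def opts (Γ : Type) [Fintype Γ] : List (Option Γ) := none :: (syms Γ).map some

omit [DecidableEq Γ] in
/-- Every symbol is enumerated. [folklore] -/
theorem mem_syms (a : Γ) : a ∈ syms Γ := Finset.mem_toList.2 (Finset.mem_univ a)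

omit [DecidableEq Γ] in
/-- Every `pop` result is enumerated. [folklore] -/
theorem mem_opts (o : Option Γ) : o ∈ opts Γ := by
  cases o with
  | none => exact List.mem_cons_self
  | some a => exact List.mem_cons_of_mem _ (List.mem_map.2 ⟨a, mem_syms a, rfl⟩)

/-- Total length of consecutive code blocks of lengths `sz x + 1` (`x ∈ xs`; each block is
followed by one jump instruction). [folklore] -/
def blocksLen {X : Type} (sz : X → ℕ) : List X → ℕ
  | [] => 0
  | x :: xs => sz x + 1 + blocksLen sz xs

/-- Start address of the block of `y` when the blocks of `xs` are laid out from `addr` (the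
first occurrence of `y`; junk if `y ∉ xs`). [folklore] -/
def blockAddr {X : Type} [DecidableEq X] (sz : X → ℕ) : List X → ℕ → X → ℕ
  | [], addr, _ => addr
  | x :: xs, addr, y => if y = x then addr else blockAddr sz xs (addr + sz x + 1) y

/-- Lay out the blocks `g x a` (`x ∈ xs`, `a` the block's own address) consecutively from
`addr`, each followed by `goto j`. [folklore] -/
def blocks {X : Type} (g : X → ℕ → AProg Γ ι) (sz : X → ℕ) (j : ℕ) : List X → ℕ → AProg Γ ι
  | [], _ => []
  | x :: xs, addr => g x addr ++ (AInstr.goto j :: blocks g sz j xs (addr + sz x + 1))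

omit [Fintype Γ] [DecidableEq Γ] in
/-- Length of a block layout. [folklore] -/
theorem length_blocks {X : Type} {g : X → ℕ → AProg Γ ι} {sz : X → ℕ} (j : ℕ)
    (hg : ∀ x a, (g x a).length = sz x) :
    ∀ (xs : List X) (addr : ℕ), (blocks g sz j xs addr).length = blocksLen sz xs
  | [], _ => rfl
  | x :: xs, addr => by
    simp [blocks, blocksLen, hg, length_blocks j hg xs]
    omega

/-- Code size of a program (number of machine instructions). [Nipkow–Klein 2014, §8.2] [folklore] -/
noncomputable def size : ACom Γ ι → ℕ
  | push _ _ => 1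
  | pop _ f => blocksLen (fun o => size (f o)) (opts Γ) + 1
  | seq c₁ c₂ => size c₁ + size c₂
  | skip => 0
  | loop _ f => blocksLen (fun a => size (f a)) (syms Γ) + 1

/-- **The compiler.** `code c base`: machine code for `c` placed at address `base`; control
leaves it at `base + size c`. Layouts: `pop k f` ↦ `pop k (table), ⟦f o₁⟧, goto exit, ⟦f o₂⟧,
goto exit, …` over the enumeration `opts Γ`; `loop k f` ↦ `pop k (table; empty ↦ exit),
⟦f a₁⟧, goto base, ⟦f a₂⟧, goto base, …` over `syms Γ`.
[Nipkow–Klein 2014, §8.2 (compilation of WHILE)] [folklore] -/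
noncomputable def code : ACom Γ ι → ℕ → AProg Γ ι
  | push k a, _ => [AInstr.push k a]
  | pop k f, base =>
    AInstr.pop k (blockAddr (fun o => size (f o)) (opts Γ) (base + 1)) ::
      blocks (fun o addr => code (f o) addr) (fun o => size (f o))
        (base + blocksLen (fun o => size (f o)) (opts Γ) + 1) (opts Γ) (base + 1)
  | seq c₁ c₂, base => code c₁ base ++ code c₂ (base + size c₁)
  | skip, _ => []
  | loop k f, base =>
    AInstr.pop k (fun o => match o with
        | none => base + blocksLen (fun a => size (f a)) (syms Γ) + 1
        | some a => blockAddr (fun a => size (f a)) (syms Γ) (base + 1) a) ::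
      blocks (fun a addr => code (f a) addr) (fun a => size (f a)) base (syms Γ) (base + 1)

/-- The code of `c` has length `size c`. [Nipkow–Klein 2014, §8.2] [folklore] -/
@[simp] theorem length_code : ∀ (c : ACom Γ ι) (base : ℕ), (code c base).length = size c
  | push k a, _ => rfl
  | pop k f, base => by
    rw [code, size, List.length_cons, length_blocks _ (fun o a => length_code (f o) a)]
  | seq c₁ c₂, base => by simp [code, size, length_code c₁, length_code c₂]
  | skip, _ => rfl
  | loop k f, base => by
    rw [code, size, List.length_cons, length_blocks _ (fun a addr => length_code (f a) addr)]

/-- The whole-program compilation: code at address `0`. [Nipkow–Klein 2014, §8.2] [folklore] -/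
noncomputable def compile (c : ACom Γ ι) : AProg Γ ι := code c 0

/-- The compiled program has length `size c`. [folklore] -/
@[simp] theorem length_compile (c : ACom Γ ι) : (compile c).length = size c := length_code c 0

/-! ### Placement of code inside a program -/

/-- `Placed Q base L`: the instructions `L` occupy addresses `base, base + 1, …` of `Q`.
[Nipkow–Klein 2014, §8.3] [folklore] -/
def Placed (Q : AProg Γ ι) (base : ℕ) (L : List (AInstr Γ ι)) : Prop :=
  ∀ i (h : i < L.length), Q[base + i]? = some L[i]

omit [Fintype Γ] [DecidableEq Γ] in
/-- Placement of a concatenation. [folklore] -/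
theorem placed_append {Q : AProg Γ ι} {base : ℕ} {L₁ L₂ : List (AInstr Γ ι)} :
    Placed Q base (L₁ ++ L₂) ↔ Placed Q base L₁ ∧ Placed Q (base + L₁.length) L₂ := by
  constructor
  · intro h
    refine ⟨fun i hi => ?_, fun i hi => ?_⟩
    · rw [h i (by simp; omega), List.getElem_append_left hi]
    · have := h (L₁.length + i) (by simp; omega)
      rw [List.getElem_append_right (by omega)] at this
      simpa [Nat.add_assoc] using this
  · rintro ⟨h₁, h₂⟩ i hi
    rw [List.length_append] at hi
    by_cases hi₁ : i < L₁.length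
    · rw [h₁ i hi₁, List.getElem_append_left hi₁]
    · obtain ⟨j, rfl⟩ := Nat.exists_eq_add_of_le (Nat.le_of_not_lt hi₁)
      rw [← Nat.add_assoc, h₂ j (by omega), List.getElem_append_right (by omega)]
      simp

omit [Fintype Γ] [DecidableEq Γ] in
/-- Placement of `x :: L`. [folklore] -/
theorem placed_cons {Q : AProg Γ ι} {base : ℕ} {x : AInstr Γ ι} {L : List (AInstr Γ ι)} :
    Placed Q base (x :: L) ↔ Q[base]? = some x ∧ Placed Q (base + 1) L := by
  rw [← List.singleton_append, placed_append]
  simp only [List.length_singleton]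
  constructor
  · rintro ⟨h, h'⟩; exact ⟨by simpa using h 0 (by simp), h'⟩
  · rintro ⟨h, h'⟩; exact ⟨fun i hi => by simp at hi; subst hi; simpa using h, h'⟩

omit [Fintype Γ] [DecidableEq Γ] in
/-- A program is placed at address `0` of itself. [folklore] -/
theorem placed_self (Q : AProg Γ ι) : Placed Q 0 Q := fun i hi => by simp [hi]

omit [Fintype Γ] [DecidableEq Γ] in
/-- A prefix is placed at address `0`. [folklore] -/
theorem placed_prefix (Q L : AProg Γ ι) : Placed (Q ++ L) 0 Q :=
  (placed_append.1 (placed_self (Q ++ L))).1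

omit [Fintype Γ] [DecidableEq Γ] in
/-- Re-addressing a placement. [folklore] -/
theorem Placed.congr_base {Q : AProg Γ ι} {b b' : ℕ} {L : List (AInstr Γ ι)} (h : Placed Q b L)
    (e : b = b') : Placed Q b' L := e ▸ h

omit [Fintype Γ] [DecidableEq Γ] in
/-- The first instruction of a placed block. [folklore] -/
theorem Placed.head {Q : AProg Γ ι} {b : ℕ} {x : AInstr Γ ι} {L : List (AInstr Γ ι)}
    (h : Placed Q b (x :: L)) : Q[b]? = some x := (placed_cons.1 h).1

omit [Fintype Γ] [DecidableEq Γ] in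
/-- The rest of a placed block. [folklore] -/
theorem Placed.tail {Q : AProg Γ ι} {b : ℕ} {x : AInstr Γ ι} {L : List (AInstr Γ ι)}
    (h : Placed Q b (x :: L)) : Placed Q (b + 1) L := (placed_cons.1 h).2

omit [Fintype Γ] [DecidableEq Γ] in
/-- The left part of a placed concatenation. [folklore] -/
theorem Placed.left {Q : AProg Γ ι} {b : ℕ} {L₁ L₂ : List (AInstr Γ ι)}
    (h : Placed Q b (L₁ ++ L₂)) : Placed Q b L₁ := (placed_append.1 h).1

omit [Fintype Γ] [DecidableEq Γ] in
/-- The right part of a placed concatenation. [folklore] -/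
theorem Placed.right {Q : AProg Γ ι} {b : ℕ} {L₁ L₂ : List (AInstr Γ ι)}
    (h : Placed Q b (L₁ ++ L₂)) : Placed Q (b + L₁.length) L₂ := (placed_append.1 h).2

omit [Fintype Γ] [DecidableEq Γ] in
/-- Placement inversion for a block layout: the block of any `y ∈ xs` sits at its address,
followed by the jump. [folklore] -/
theorem placed_blocks {X : Type} [DecidableEq X] {Q : AProg Γ ι} {g : X → ℕ → AProg Γ ι}
    {sz : X → ℕ} {j : ℕ} (hg : ∀ x a, (g x a).length = sz x) :
    ∀ {xs : List X} {addr : ℕ}, Placed Q addr (blocks g sz j xs addr) → ∀ {y : X}, y ∈ xs →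
      Placed Q (blockAddr sz xs addr y) (g y (blockAddr sz xs addr y)) ∧
        Q[blockAddr sz xs addr y + sz y]? = some (AInstr.goto j)
  | [], _, _, _, hy => absurd hy List.not_mem_nil
  | x :: xs, addr, hp, y, hy => by
    rw [blocks] at hp
    by_cases hyx : y = x
    · subst hyx
      rw [blockAddr, if_pos rfl]
      refine ⟨hp.left, ?_⟩
      have h := hp.right.head
      rwa [hg] at h
    · rw [blockAddr, if_neg hyx]
      have hy' : y ∈ xs := (List.mem_cons.1 hy).resolve_left hyx
      have h2 : Placed Q (addr + sz x + 1) (blocks g sz j xs (addr + sz x + 1)) :=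
        hp.right.tail.congr_base (by rw [hg])
      exact placed_blocks hg h2 hy'

/-! ### Adequacy of the cost semantics -/

variable [DecidableEq ι]

omit [Fintype Γ] [DecidableEq Γ] in
/-- Padding: once a halted address is reached, later iterates stay there. [folklore] -/
theorem iterate_of_reached {Q : AProg Γ ι} {fin : ℕ} (hfin : Q.length ≤ fin) {c : ACfg Γ ι}
    {R' : AStore Γ ι} {t t' : ℕ} (h : Q.step^[t] c = ⟨fin, R'⟩) (ht : t ≤ t') :
    Q.step^[t'] c = ⟨fin, R'⟩ := by
  obtain ⟨d, rfl⟩ := Nat.exists_eq_add_of_le ht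
  rw [Nat.add_comm, Function.iterate_add_apply, h]
  exact Q.iterate_step_of_le (c := ⟨fin, R'⟩) hfin d

omit [Fintype Γ] [DecidableEq Γ] [DecidableEq ι] in
/-- Configurations with equal components are equal (for closing address arithmetic).
[folklore] -/
theorem cfg_eq_of {pc pc' : ℕ} {R : AStore Γ ι} (h : pc = pc') :
    (⟨pc, R⟩ : ACfg Γ ι) = ⟨pc', R⟩ := by
  rw [h]

/-- **Adequacy (compiler correctness with exact step counts).** If `Exec c R R' t` and the code
of `c` is placed at `base` in `Q`, then `t` steps of `Q` lead from `⟨base, R⟩` to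
`⟨base + size c, R'⟩`.
[Nipkow–Klein 2014, §8.3, Lemma 8.9 / Thm. 8.10 (big-step ⇒ machine execution)] [folklore] -/
theorem Exec.iterate_step {Q : AProg Γ ι} {c : ACom Γ ι} {R R' : AStore Γ ι} {t : ℕ}
    (h : Exec c R R' t) :
    ∀ {base : ℕ}, Placed Q base (code c base) → Q.step^[t] ⟨base, R⟩ = ⟨base + c.size, R'⟩ := by
  induction h with
  | push =>
    intro base hp
    rw [code] at hp
    simp [Q.step_of_getElem? hp.head, size]
  | @pop_cons k f R R' a w t hk h ih =>
    intro base hp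
    rw [code] at hp
    obtain ⟨hblk, hgoto⟩ := placed_blocks (fun o addr => length_code (f o) addr) hp.tail
      (mem_opts (some a))
    rw [show t + 2 = (t + 1) + 1 from rfl, Function.iterate_succ_apply,
      Q.step_of_getElem? hp.head]
    simp only [hk]
    rw [Function.iterate_succ_apply', ih hblk, Q.step_of_getElem? hgoto]
    exact cfg_eq_of (by simp [size]; omega)
  | @pop_nil k f R R' t hk h ih =>
    intro base hp
    rw [code] at hp
    obtain ⟨hblk, hgoto⟩ := placed_blocks (fun o addr => length_code (f o) addr) hp.tail
      (mem_opts (none : Option Γ))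
    rw [show t + 2 = (t + 1) + 1 from rfl, Function.iterate_succ_apply,
      Q.step_of_getElem? hp.head]
    simp only [hk]
    rw [Function.iterate_succ_apply', ih hblk, Q.step_of_getElem? hgoto]
    exact cfg_eq_of (by simp [size]; omega)
  | @seq c₁ c₂ R R₁ R₂ t₁ t₂ h₁ h₂ ih₁ ih₂ =>
    intro base hp
    rw [code] at hp
    have hp₂ : Placed Q (base + size c₁) (code c₂ (base + size c₁)) :=
      hp.right.congr_base (by rw [length_code])
    rw [Nat.add_comm t₁ t₂, Function.iterate_add_apply, ih₁ hp.left, ih₂ hp₂]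
    exact cfg_eq_of (by simp [size]; omega)
  | skip => intro base hp; simp [size]
  | loop_nil hk =>
    intro base hp
    rw [code] at hp
    simp only [Function.iterate_one, Q.step_of_getElem? hp.head, hk]
    exact cfg_eq_of (by simp [size]; omega)
  | @loop_cons k f R R₁ R₂ a w t₁ t₂ hk h₁ h₂ ih₁ ih₂ =>
    intro base hp
    have hp' := hp
    rw [code] at hp
    obtain ⟨hblk, hgoto⟩ := placed_blocks (fun a addr => length_code (f a) addr) hp.tail
      (mem_syms a)
    rw [show t₁ + 2 + t₂ = t₂ + ((t₁ + 1) + 1) by omega, Function.iterate_add_apply,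
      Function.iterate_succ_apply, Q.step_of_getElem? hp.head]
    simp only [hk]
    rw [Function.iterate_succ_apply', ih₁ hblk, Q.step_of_getElem? hgoto]
    exact ih₂ hp'

/-- **The compiled program realises the cost semantics**: an execution of cost `t` is `t`
machine steps from `⟨0, R⟩` to `⟨size c, R'⟩`. [Nipkow–Klein 2014, §8.3, Thm. 8.10] [folklore] -/
theorem Exec.compile_iterate {c : ACom Γ ι} {R R' : AStore Γ ι} {t : ℕ} (h : Exec c R R' t) :
    (compile c).step^[t] ⟨0, R⟩ = ⟨c.size, R'⟩ := by
  have h0 := h.iterate_step (Q := compile c) (base := 0)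
    (by simpa [compile] using placed_self (compile c))
  simpa using h0

end Compile

end ACom

/-! ### Stack register machines are `TM2` machines -/

namespace AProg

open Turing

section Machine

variable {Γ ι : Type} [Fintype Γ] [DecidableEq ι] [Fintype ι]
variable (P : AProg Γ ι) (hP : 0 < P.length) (inp out : ι)

/-- The jump part of a translated instruction: go to the address `j v` computed from the
register symbol `v` just popped (constant for `push`/`goto`), or — if that address is beyond the
program — reset the state and halt. [folklore] -/
def jmp (n : ℕ) (hn : 0 < n) (j : Option Γ → ℕ) : TM2.Stmt (fun _ : ι => Γ) (Fin n) (Option Γ) :=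
  .branch (fun v => decide (j v < n))
    (.goto fun v => if h : j v < n then ⟨j v, h⟩ else ⟨0, hn⟩)
    (.load (fun _ => none) .halt)

/-- Translation of one instruction at address `pc` into a `TM2` statement (one machine step).
[folklore] -/
def trInstr (n : ℕ) (hn : 0 < n) (pc : ℕ) :
    AInstr Γ ι → TM2.Stmt (fun _ : ι => Γ) (Fin n) (Option Γ)
  | .push k a => .push k (fun _ => a) (jmp n hn fun _ => pc + 1)
  | .goto j => jmp n hn fun _ => j
  | .pop k j => .pop k (fun _ o => o) (jmp n hn j)

/-- **The `TM2` machine of a stack register program**: stacks = registers (all over `Γ`), input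
stack `inp`, output stack `out`, labels = addresses, internal state = the symbol last popped
(reset to `none` on halting), statement at address `pc` = the translated instruction.
[Minsky 1967, §14.1; Arora–Barak 2009, §1.2] [folklore] -/
@[reducible] def tm : FinTM2 where
  K := ι
  k₀ := inp
  k₁ := out
  Γ := fun _ => Γ
  Λ := Fin P.length
  main := ⟨0, hP⟩
  σ := Option Γ
  initialState := none
  m := fun l => trInstr P.length hP l.val (P[l.val]'l.isLt)

/-- The bundled machine, input and output alphabets being `Γ` itself. [folklore] -/
@[reducible] def aux : TM2ComputableAux Γ Γ where
  tm := tm P hP inp out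
  inputAlphabet := Equiv.refl Γ
  outputAlphabet := Equiv.refl Γ

/-- The label of an address (`none` = halted, beyond the program). [folklore] -/
def lbl (pc : ℕ) : Option (Fin P.length) := if h : pc < P.length then some ⟨pc, h⟩ else none

/-- The machine configuration of a register-machine configuration, with internal state `v`
(forced to `none` when halted). [folklore] -/
def cfgOf (c : ACfg Γ ι) (v : Option Γ) : (tm P hP inp out).Cfg :=
  ⟨lbl P c.pc, if c.pc < P.length then v else none, c.regs⟩

omit [Fintype Γ] [Fintype ι] in
/-- Semantics of the jump part. [folklore] -/
theorem stepAux_jmp (j : Option Γ → ℕ) (v : Option Γ) (S : AStore Γ ι) :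
    TM2.stepAux (jmp (ι := ι) P.length hP j) v S =
      ⟨lbl P (j v), if j v < P.length then v else none, S⟩ := by
  unfold jmp lbl
  by_cases h : j v < P.length
  · simp [h]
  · simp [h]

/-- **One instruction is one machine step.** [folklore] -/
theorem step_cfgOf (c : ACfg Γ ι) (hc : c.pc < P.length) (v : Option Γ) :
    ∃ v', (tm P hP inp out).step (cfgOf P hP inp out c v) =
      some (cfgOf P hP inp out (P.step c) v') := by
  obtain ⟨pc, R⟩ := c
  change pc < P.length at hc
  set ins : AInstr Γ ι := P[pc]'hc with hins
  have hget : P[pc]? = some ins := by rw [hins]; exact List.getElem?_eq_getElem hc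
  have hl : lbl P pc = some ⟨pc, hc⟩ := by simp [lbl, hc]
  have hstep : (tm P hP inp out).step (cfgOf P hP inp out ⟨pc, R⟩ v) =
      some (TM2.stepAux (trInstr P.length hP pc ins) v R) := by
    simp only [FinTM2.step, cfgOf, hl, if_pos hc, hins]
    rfl
  clear_value ins
  rw [hstep, P.step_of_getElem? hget]
  cases ins with
  | push k a =>
    refine ⟨v, ?_⟩
    simp only [trInstr, TM2.stepAux, stepAux_jmp]
    rfl
  | goto j =>
    refine ⟨v, ?_⟩
    simp only [trInstr, stepAux_jmp]
    rfl
  | pop k j =>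
    simp only [trInstr, TM2.stepAux, stepAux_jmp]
    cases hk : R k with
    | nil =>
      refine ⟨none, ?_⟩
      simp only [List.head?_nil, List.tail_nil]
      rw [show Function.update R k [] = R by rw [← hk]; exact Function.update_eq_self k R]
      rfl
    | cons a w =>
      refine ⟨some a, ?_⟩
      simp only [List.head?_cons, List.tail_cons]
      rfl

/-- Runs of the register machine that stay inside the program are runs of the machine.
[folklore] -/
theorem iterate_cfgOf (n : ℕ) :
    ∀ (c : ACfg Γ ι), (∀ m < n, (P.step^[m] c).pc < P.length) → ∀ v : Option Γ,
      ∃ v', (flip bind (tm P hP inp out).step)^[n] (some (cfgOf P hP inp out c v)) =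
        some (cfgOf P hP inp out (P.step^[n] c) v') := by
  induction n with
  | zero => intro c _ v; exact ⟨v, rfl⟩
  | succ n ih =>
    intro c hc v
    obtain ⟨v₁, h₁⟩ := step_cfgOf P hP inp out c (hc 0 (Nat.succ_pos n)) v
    obtain ⟨v', h'⟩ := ih (P.step c) (fun m hm => by
      rw [← Function.iterate_succ_apply]; exact hc (m + 1) (by omega)) v₁
    refine ⟨v', ?_⟩
    rw [TM2Comp.iterate_bind_succ, h₁, h', Function.iterate_succ_apply]

/-- **Exact running time on `TM2`.** If `t` steps of the register machine lead from the input
configuration (address `0`, the word `z` in register `inp`, all other registers empty) to a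
halted configuration with `w` in register `out` and all other registers empty, then the machine
outputs `w` on input `z` within `t` steps. [Arora–Barak 2009, §1.2; Minsky 1967, §14.1]
[folklore] -/
theorem outputsWithin_of_iterate {z w : List Γ} {t pc : ℕ}
    (h : P.step^[t] ⟨0, AStore.single inp z⟩ = ⟨pc, AStore.single out w⟩)
    (hpc : P.length ≤ pc) : (aux P hP inp out).OutputsWithin z w t := by
  classical
  set c₀ : ACfg Γ ι := ⟨0, AStore.single inp z⟩ with hc₀
  have hex : ∃ n, P.length ≤ (P.step^[n] c₀).pc := ⟨t, by rw [h]; exact hpc⟩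
  set n₀ := Nat.find hex with hn₀
  have hn₀t : n₀ ≤ t := Nat.find_min' hex (by rw [h]; exact hpc)
  have hreach : P.length ≤ (P.step^[n₀] c₀).pc := Nat.find_spec hex
  have hbefore : ∀ m < n₀, (P.step^[m] c₀).pc < P.length := fun m hm =>
    Nat.lt_of_not_le (Nat.find_min hex hm)
  -- the halted configuration reached at `n₀` is the final one
  have hfin : P.step^[n₀] c₀ = ⟨pc, AStore.single out w⟩ := by
    have e : P.step^[t] c₀ = P.step^[t - n₀] (P.step^[n₀] c₀) := by
      rw [← Function.iterate_add_apply, Nat.sub_add_cancel hn₀t]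
    rw [← h, e, P.iterate_step_of_le hreach]
  obtain ⟨v', hv'⟩ := iterate_cfgOf P hP inp out n₀ c₀ hbefore none
  rw [hfin] at hv'
  -- identify the endpoints with Mathlib's `initList` / `haltList`
  have hinit : cfgOf P hP inp out c₀ none = initList (tm P hP inp out) z := by
    rw [TM2Comp.initList_eq]
    simp only [cfgOf, hc₀, lbl, dif_pos hP, ite_self, AStore.single_eq_update]
  have hhalt : cfgOf P hP inp out ⟨pc, AStore.single out w⟩ v' =
      haltList (tm P hP inp out) w := by
    rw [TM2Comp.haltList_eq]
    simp only [cfgOf, lbl, dif_neg (Nat.not_lt.2 hpc), if_neg (Nat.not_lt.2 hpc),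
      AStore.single_eq_update]
  have ez : (z.map ((Equiv.refl Γ).symm) : List Γ) = z := by simp
  have ew : (w.map ((Equiv.refl Γ).symm) : List Γ) = w := by simp
  refine ⟨⟨⟨n₀, ?_⟩, hn₀t⟩⟩
  change (flip bind (tm P hP inp out).step)^[n₀]
      (some (initList (tm P hP inp out) (z.map (Equiv.refl Γ).symm))) =
    some (haltList (tm P hP inp out) (w.map (Equiv.refl Γ).symm))
  rw [ez, ew, ← hinit, ← hhalt]
  exact hv'

end Machine

end AProg

/-! ### From structured programs with a cost bound to `ComputesInTime` -/

namespace ACom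

open Turing

variable {Γ ι : Type} [Fintype Γ] [DecidableEq Γ] [DecidableEq ι] [Fintype ι]

/-- **Structured stack programs compute in the time given by their cost semantics.** If for
every input `a` the program `c`, started with `ea a` in register `inp` and all other registers
empty, runs within budget `T a` and ends with `eb (f a)` in register `out` and all other
registers empty, then `f` is computed by a `TM2` machine (over the alphabet `Γ` of the
encodings, without transcoding) within `T a + 1` steps on every input `a`, in the sense of
`Literature.Computability.Complexity.ComputesInTime` (= `Literature.Computability.FineGrained.ComputesInTime`, `exists_computesInTime_iff`).
[Nipkow–Klein 2014, Ch. 8; Arora–Barak 2009, §1.2–1.3; Minsky 1967, §14.1] [folklore] -/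
theorem exists_computesInTime {α β : Type} (c : ACom Γ ι) (inp out : ι) (ea : α → List Γ)
    (eb : β → List Γ) (f : α → β) (T : α → ℕ)
    (h : ∀ a, Runs c (AStore.single inp (ea a)) (AStore.single out (eb (f a))) (T a)) :
    ∃ M : TM2ComputableAux Γ Γ, ComputesInTime ea eb f (fun a => T a + 1) M := by
  set P : AProg Γ ι := compile c ++ [AInstr.goto (c.size + 1)] with hPdef
  have hlen : P.length = c.size + 1 := by simp [hPdef]
  have hP : 0 < P.length := by omega
  refine ⟨AProg.aux P hP inp out, fun a => ?_⟩
  obtain ⟨t, ht, e⟩ := h a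
  have h1 : P.step^[t] ⟨0, AStore.single inp (ea a)⟩ = ⟨c.size, AStore.single out (eb (f a))⟩ :=
    e.iterate_step (Q := P) (base := 0) (by
      simpa [hPdef, compile] using placed_prefix (compile c) [AInstr.goto (c.size + 1)])
      |>.trans (cfg_eq_of (by simp))
  have hgoto : P[c.size]? = some (AInstr.goto (c.size + 1)) := by
    simp [hPdef]
  have h2 : P.step^[t + 1] ⟨0, AStore.single inp (ea a)⟩ =
      ⟨c.size + 1, AStore.single out (eb (f a))⟩ := by
    rw [Function.iterate_succ_apply', h1, P.step_of_getElem? hgoto]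
  exact (AProg.outputsWithin_of_iterate P hP inp out h2 (by omega)).mono (Nat.succ_le_succ ht)

end ACom

end Literature.Computability.Complexity
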